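import Literature.AlgebraicGeometry.HodgeTheory.RegularFormRealizationNaturality
import Literature.AlgebraicGeometry.HodgeTheory.AnalyticModelOpenSubscheme
import Literature.Geometry.Kaehler.OpensExtendReal
import Literature.Geometry.Kaehler.LocalForms
import HarnessLib

/-!
# Holomorphic images of regular forms on an affine open piece, as local forms on `Y^an`

[topic AlgebraicGeometry/HodgeTheory]

Let `Y` be a smooth `ℂ`-scheme with analytic model `A` (`Y^an = A.carrier`, comparison
`ψ : Y^an → Y(ℂ)`), and `O ⊆ Y` an AFFINE open with coordinates `x : Fin N → Γ(O, 𝒪)`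
(`φ_x = coordPresentation (Y|_O) x`) and relations `I ⊆ ker φ_x`. The open piece
`ψ⁻¹(O(ℂ)) = A.openSet O ⊆ Y^an` is the analytic model `A.restrictOpen O` of `Y|_O`
(`AnalyticModelOpenSubscheme`, [SerreGAGA1956, §2 n°5]), on which Grothendieck's comparison map
realises a regular `q`-form `r ∈ Ω^q(V(I)) → Ω^q(O)` as the holomorphic form
`regularFormRealize (A.restrictOpen O) x hI q r` [Grothendieck1966, (5)] — a form on the open
SUBMANIFOLD `↥(A.openSet O)`. The tree's Čech–de Rham complex of an open cover
(`Geometry/Kaehler/CechDeRham`, [BottTu1982Forms, §8]) is written instead with the LOCAL forms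
`smoothFormsOn 𝓘(ℝ, E) ℂ U q ⊆ MForm 𝓘(ℝ, E) Y^an ℂ q` of `Geometry/Kaehler/LocalForms` (forms on
`Y^an` smooth on `U` and zero off `U`). This file bridges the two, so that the columns of the
algebraic Čech–de Rham complex of an affine cover realise inside the smooth one:

* `MForm.extendZero` — extension by zero of a form on an open submanifold `↥U` to the ambient
  manifold (the tree's `MForm.extendOpensReal` without base point: `extendZero_eq_extendOpensReal`),
  with `pullback_subtypeVal_extendZero` (restricting back gives the form), `smoothAt_extendZero`,
  `extendZero_mem_smoothFormsOn`, **`mextDeriv_extendZero_apply_of_mem`** (`d` commutes with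
  extension on `U`, from the tree's `mextDeriv_pullback_subtypeVal_apply`), and
  **`extendZero_pullback_inclusion`** (extension of the restriction to a smaller open `U ≤ V` is the
  cut-off `restr U`, since the inclusion `U → V` has identity differential);
* `AnalyticModel.realizeOn A x hI q : RegularForm I q →ₗ[ℂ] MForm 𝓘(ℝ, E) A.carrier ℂ q` — the
  holomorphic image on the open piece extended by zero, and its `smoothFormsOn`-valued form
  `AnalyticModel.localRealize` (`ℝ`-linear), with `realizeOn_apply_of_mem / _of_notMem`,
  `pullback_subtypeVal_realizeOn`;
* **`AnalyticModel.localD_localRealize`** — `d_U ∘ localRealize = localRealize ∘ d`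
  (`regularFormRealize_d` [Grothendieck1966, (5): compatible with `d`]);
* **`AnalyticModel.restrictₗ_localRealize`** — for affine opens `O₁ ≤ O₂`, coordinates `x₁`, `x₂`
  and a polynomial lift `F` of the inclusion (`hF`), `restrictₗ ∘ localRealize_{O₂} =
  localRealize_{O₁} ∘ F^*`: the naturality of Grothendieck's comparison map
  (`regularFormRealize_pullback_anMap`, node P2-nat) along `Y|_{O₁} ⟶ Y|_{O₂}`, whose
  analytification is the inclusion of open pieces (`anMap_restrictOpen_homOfLE`).

Everything is proved; definitions with bodies (`MForm.extendZero`, `extendZeroₗ`, `realizeOn`,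
`localRealize`); no named facts (net debt 0).

## References

* [Grothendieck1966] A. Grothendieck, *On the de Rham cohomology of algebraic varieties*, Publ.
  Math. IHÉS 29 (1966), p. 96 (5)–(6).
* [SerreGAGA1956] J.-P. Serre, *Géométrie algébrique et géométrie analytique*, §2 n°5.
* [BottTu1982Forms] R. Bott, L. W. Tu, *Differential Forms in Algebraic Topology*, §I.1, §8.
* [LeeSmoothManifolds2013] J. M. Lee, *Introduction to Smooth Manifolds*, 2nd ed., Example 1.26,
  Prop. 3.9 (open submanifolds, `T_p U = T_p M`), Lemma 2.26 (extension by zero).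
* [WarnerGTM94] F. Warner, *Foundations of Differentiable Manifolds and Lie Groups*, 2.22–2.23.
-/

noncomputable section

open scoped Manifold ContDiff Topology
open Set TopologicalSpace

/-! ### Extension by zero from an open submanifold, without base point -/

namespace Literature.Geometry.Kaehler

section ExtendZero

variable {E : Type*} [NormedAddCommGroup E] [NormedSpace ℝ E]
  {F : Type*} [NormedAddCommGroup F] [NormedSpace ℝ F]
  {M : Type*} [TopologicalSpace M] [ChartedSpace E M] {U : Opens M} {k : ℕ}

/-- **Extension by zero** of a form on the open submanifold `↥U` to the ambient manifold
(`T_m U = T_m M = E`): `β` on `U`, `0` off `U`. [cite: LeeSmoothManifolds2013, Lemma 2.26] -/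
def MForm.extendZero (β : MForm 𝓘(ℝ, E) U F k) : MForm 𝓘(ℝ, E) M F k :=
  fun m ↦ by classical exact if hm : m ∈ U then β ⟨m, hm⟩ else 0

/-- On `U` the extension is the form. [cite: LeeSmoothManifolds2013, Lemma 2.26] -/
theorem MForm.extendZero_apply_of_mem (β : MForm 𝓘(ℝ, E) U F k) {m : M} (hm : m ∈ U) :
    β.extendZero m = β ⟨m, hm⟩ := by
  unfold MForm.extendZero
  rw [dif_pos hm]

/-- Off `U` the extension vanishes. [cite: LeeSmoothManifolds2013, Lemma 2.26] -/
theorem MForm.extendZero_apply_of_notMem (β : MForm 𝓘(ℝ, E) U F k) {m : M} (hm : m ∉ U) :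
    β.extendZero m = 0 := by
  unfold MForm.extendZero
  rw [dif_neg hm]

/-- The extension by zero is the tree's `extendOpensReal` for any base point.
[cite: LeeSmoothManifolds2013, Lemma 2.26] -/
theorem MForm.extendZero_eq_extendOpensReal (β : MForm 𝓘(ℝ, E) U F k) (w₀ : U) :
    β.extendZero = β.extendOpensReal w₀ := by
  funext m
  by_cases hm : m ∈ U
  · ext v
    rw [β.extendZero_apply_of_mem hm, MForm.extendOpensReal_apply_of_mem β hm]
    rfl
  · rw [β.extendZero_apply_of_notMem hm, MForm.extendOpensReal_apply_of_notMem β hm]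

/-- Restricting the extension back to `↥U` gives the form. [cite: LeeSmoothManifolds2013, Prop. 3.9] -/
theorem MForm.pullback_subtypeVal_extendZero (β : MForm 𝓘(ℝ, E) U F k) :
    β.extendZero.pullback 𝓘(ℝ, E) (Subtype.val : U → M) = β := by
  funext w
  ext v
  rw [MForm.pullback_subtypeVal_apply, β.extendZero_apply_of_mem w.2]
  rfl

/-- Extension by zero is additive. [cite: LeeSmoothManifolds2013, Lemma 2.26] -/
theorem MForm.extendZero_add (β β' : MForm 𝓘(ℝ, E) U F k) :
    (β + β').extendZero = β.extendZero + β'.extendZero := by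
  funext m
  by_cases hm : m ∈ U
  · rw [Pi.add_apply, MForm.extendZero_apply_of_mem _ hm, β.extendZero_apply_of_mem hm,
      β'.extendZero_apply_of_mem hm]
    rfl
  · rw [Pi.add_apply, MForm.extendZero_apply_of_notMem _ hm, β.extendZero_apply_of_notMem hm,
      β'.extendZero_apply_of_notMem hm, add_zero]

/-- Extension by zero commutes with scalars (any scalars acting on the coefficients compatibly
with `ℝ`, e.g. `ℂ` on `ℂ`-valued forms). [cite: LeeSmoothManifolds2013, Lemma 2.26] -/
theorem MForm.extendZero_smul {R : Type*} [Semiring R] [Module R F] [SMulCommClass ℝ R F]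
    [ContinuousConstSMul R F] (c : R) (β : MForm 𝓘(ℝ, E) U F k) :
    (c • β).extendZero = c • β.extendZero := by
  funext m
  by_cases hm : m ∈ U
  · rw [Pi.smul_apply, MForm.extendZero_apply_of_mem _ hm, β.extendZero_apply_of_mem hm]
    rfl
  · rw [Pi.smul_apply, MForm.extendZero_apply_of_notMem _ hm, β.extendZero_apply_of_notMem hm,
      smul_zero]

/-- Extension by zero of the zero form. [cite: LeeSmoothManifolds2013, Lemma 2.26] -/
theorem MForm.extendZero_zero : (0 : MForm 𝓘(ℝ, E) U F k).extendZero = 0 := by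
  funext m
  by_cases hm : m ∈ U
  · rw [MForm.extendZero_apply_of_mem _ hm]
    rfl
  · rw [MForm.extendZero_apply_of_notMem _ hm]
    rfl

/-- The inclusion of opens `U ≤ V` has identity differential (restated from the Lorentzian files'
`mfderiv_inclusion` to keep imports light). [folklore] -/
private theorem mfderiv_inclusion' {U V : Opens M} (h : U ≤ V) (y : U) :
    mfderiv 𝓘(ℝ, E) 𝓘(ℝ, E) (Opens.inclusion h) y = ContinuousLinearMap.id ℝ E := by
  have hincl : MDifferentiableAt 𝓘(ℝ, E) 𝓘(ℝ, E) (Opens.inclusion h) y :=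
    (contMDiff_inclusion (n := 1) h y).mdifferentiableAt one_ne_zero
  have hc := mfderiv_comp y
    (Literature.Geometry.Manifold.OpenSubmanifold.hasMFDerivAt_subtype_val (I := 𝓘(ℝ, E))
      (Opens.inclusion h y)).mdifferentiableAt hincl
  change mfderiv 𝓘(ℝ, E) 𝓘(ℝ, E) (Subtype.val : U → M) y = _ at hc
  rw [Literature.Geometry.Manifold.OpenSubmanifold.mfderiv_subtype_val,
    Literature.Geometry.Manifold.OpenSubmanifold.mfderiv_subtype_val] at hc
  rw [← ContinuousLinearMap.id_comp (mfderiv 𝓘(ℝ, E) 𝓘(ℝ, E) (Opens.inclusion h) y)]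
  exact hc.symm

/-- **Restriction to a smaller open submanifold**: the pull-back along the inclusion `U → V` of
opens is the form read on `U` (`T_y U = T_y V`). [cite: LeeSmoothManifolds2013, Prop. 3.9] -/
theorem MForm.pullback_inclusion_apply {U V : Opens M} (h : U ≤ V) (β : MForm 𝓘(ℝ, E) V F k)
    (y : U) (v : Fin k → TangentSpace 𝓘(ℝ, E) y) :
    β.pullback 𝓘(ℝ, E) (Opens.inclusion h) y v = β (Opens.inclusion h y) v := by
  rw [MForm.pullback_apply, mfderiv_inclusion' h y]
  rfl

/-- **Extension by zero of a restriction is the cut-off**: for opens `U ≤ V` and a form `β` on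
`↥V`, extending `β|_U` by zero gives the extension of `β` cut off to `U`.
[cite: LeeSmoothManifolds2013, Lemma 2.26] -/
theorem MForm.extendZero_pullback_inclusion {U V : Opens M} (h : U ≤ V) (β : MForm 𝓘(ℝ, E) V F k) :
    (β.pullback 𝓘(ℝ, E) (Opens.inclusion h)).extendZero = β.extendZero.restr (U : Set M) := by
  funext m
  by_cases hm : m ∈ U
  · ext v
    rw [MForm.extendZero_apply_of_mem _ hm, MForm.restr_apply_of_mem _ hm,
      β.extendZero_apply_of_mem (h hm)]
    exact MForm.pullback_inclusion_apply h β ⟨m, hm⟩ v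
  · rw [MForm.extendZero_apply_of_notMem _ hm, MForm.restr_apply_of_notMem _ hm]

variable [IsManifold 𝓘(ℝ, E) ∞ M]

/-- The extension by zero is smooth at the points of `U` where the form is.
[cite: LeeSmoothManifolds2013, Lemma 2.26] -/
theorem MForm.smoothAt_extendZero {β : MForm 𝓘(ℝ, E) U F k} {m : M} (hm : m ∈ U)
    (hβ : β.SmoothAt ⟨m, hm⟩) : β.extendZero.SmoothAt m := by
  rw [β.extendZero_eq_extendOpensReal ⟨m, hm⟩]
  exact MForm.smoothAt_extendOpensReal hm hβ

/-- **A smooth form on `↥U` extends by zero to a local form on `U`** (`smoothFormsOn`: smooth on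
`U`, zero off `U`). [cite: BottTu1982Forms, §I.1] -/
theorem MForm.extendZero_mem_smoothFormsOn {β : MForm 𝓘(ℝ, E) U F k} (hβ : IsSmoothForm β) :
    β.extendZero ∈ smoothFormsOn 𝓘(ℝ, E) F (U : Set M) k :=
  ⟨fun _ hm ↦ MForm.smoothAt_extendZero hm (hβ _), fun _ hm ↦ β.extendZero_apply_of_notMem hm⟩

/-- **`d` commutes with extension by zero on `U`**: at a point of `U` where `β` is smooth,
`d(extendZero β) = dβ`. [cite: WarnerGTM94, Prop. 2.23] -/
theorem MForm.mextDeriv_extendZero_apply_of_mem {β : MForm 𝓘(ℝ, E) U F k} {m : M} (hm : m ∈ U)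
    (hβ : β.SmoothAt ⟨m, hm⟩) : mextDeriv β.extendZero m = mextDeriv β ⟨m, hm⟩ := by
  have h := fun v ↦ mextDeriv_pullback_subtypeVal_apply (U := U) (x := ⟨m, hm⟩)
    (β := β.extendZero) (MForm.smoothAt_extendZero hm hβ) v
  rw [β.pullback_subtypeVal_extendZero] at h
  ext v
  exact (h v).symm

/-- The extension by zero of `dβ` is `d` of the extension, cut off to `U` (for `β` smooth).
[cite: WarnerGTM94, Prop. 2.23] -/
theorem MForm.extendZero_mextDeriv {β : MForm 𝓘(ℝ, E) U F k} (hβ : IsSmoothForm β) :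
    (mextDeriv β).extendZero = (mextDeriv β.extendZero).restr (U : Set M) := by
  funext m
  by_cases hm : m ∈ U
  · rw [MForm.extendZero_apply_of_mem _ hm, MForm.restr_apply_of_mem _ hm,
      MForm.mextDeriv_extendZero_apply_of_mem hm (hβ _)]
  · rw [MForm.extendZero_apply_of_notMem _ hm, MForm.restr_apply_of_notMem _ hm]

/-- `dβ` is smooth for `β` smooth (pointwise form of the tree's `isSmoothForm_mextDeriv`, via
`MForm.SmoothAt.mextDeriv`). [cite: WarnerGTM94, Thm. 2.20] -/
theorem isSmoothForm_mextDeriv_of_isSmoothForm {N : Type*} [TopologicalSpace N] [ChartedSpace E N]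
    [IsManifold 𝓘(ℝ, E) ∞ N] {β : MForm 𝓘(ℝ, E) N F k} (hβ : IsSmoothForm β) :
    IsSmoothForm (mextDeriv β) :=
  fun _ ↦ MForm.SmoothAt.mextDeriv (Filter.Eventually.of_forall fun z ↦ hβ z)

/-- **`d_U` of the extension by zero is the extension by zero of `dβ`** (in `smoothFormsOn U`).
[cite: BottTu1982Forms, §I.1] -/
theorem localD_extendZero {β : MForm 𝓘(ℝ, E) U F k} (hβ : IsSmoothForm β) :
    localD 𝓘(ℝ, E) F k U.isOpen ⟨β.extendZero, MForm.extendZero_mem_smoothFormsOn hβ⟩ =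
      ⟨(mextDeriv β).extendZero, MForm.extendZero_mem_smoothFormsOn (isSmoothForm_mextDeriv_of_isSmoothForm hβ)⟩ :=
  Subtype.ext (MForm.extendZero_mextDeriv hβ).symm

end ExtendZero

end Literature.Geometry.Kaehler

/-! ### Holomorphic images on an affine open piece -/

open CategoryTheory AlgebraicGeometry MvPolynomial
open Literature.NumberTheory.Transcendental Literature.Geometry.Kaehler
open Literature.AlgebraicGeometry.Motives Literature.AlgebraicGeometry.Motives.AffineDeRham

namespace Literature.AlgebraicGeometry.HodgeTheory

section HodgeTheory

variable {E : Type} [NormedAddCommGroup E] [NormedSpace ℂ E] [FiniteDimensional ℂ E] {m : ℕ}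
  {Y : Motives.SchemeOver ℂ} (A : AnalyticModel E m Y) {O : Y.left.Opens}
  [IsAffine (Motives.openSubschemeOver Y O).left] {N : ℕ}
  (x : Fin N → Γ((Motives.openSubschemeOver Y O).left, ⊤))
  {I : Ideal (MvPolynomial (Fin N) ℂ)}
  (hI : I ≤ RingHom.ker (coordPresentation (Motives.openSubschemeOver Y O) x))

namespace AnalyticModel

/-- **The holomorphic image of a regular form on the affine open piece `O`, extended by zero to
`Y^an`**: `regularFormRealize (A.restrictOpen O) x hI q r` on `ψ⁻¹(O(ℂ))`, `0` elsewhere.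
[cite: Grothendieck1966, (5)–(6)] -/
def realizeOn (q : ℕ) : RegularForm I q →ₗ[ℂ] MForm 𝓘(ℝ, E) A.carrier ℂ q where
  toFun r := MForm.extendZero (U := A.openSet O) (regularFormRealize (A.restrictOpen O) x hI q r)
  map_add' r r' := by
    rw [map_add]
    exact MForm.extendZero_add _ _
  map_smul' c r := by
    rw [map_smul]
    exact MForm.extendZero_smul c _

/-- `realizeOn` is the extension by zero of the holomorphic image on the open piece (definitional).
[cite: Grothendieck1966, (5)–(6)] -/
theorem realizeOn_apply (q : ℕ) (r : RegularForm I q) :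
    A.realizeOn x hI q r =
      MForm.extendZero (U := A.openSet O) (regularFormRealize (A.restrictOpen O) x hI q r) :=
  rfl

/-- On the open piece, `realizeOn` is the holomorphic image. [cite: Grothendieck1966, (5)] -/
theorem realizeOn_apply_of_mem (q : ℕ) (r : RegularForm I q) {z : A.carrier} (hz : z ∈ A.openSet O) :
    A.realizeOn x hI q r z = regularFormRealize (A.restrictOpen O) x hI q r ⟨z, hz⟩ :=
  MForm.extendZero_apply_of_mem _ hz

/-- Off the open piece, `realizeOn` vanishes. [cite: Grothendieck1966, (6)] -/
theorem realizeOn_apply_of_notMem (q : ℕ) (r : RegularForm I q) {z : A.carrier}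
    (hz : z ∉ A.openSet O) : A.realizeOn x hI q r z = 0 :=
  MForm.extendZero_apply_of_notMem _ hz

/-- `realizeOn` on the class of a polynomial form. [cite: Grothendieck1966, (5)] -/
theorem realizeOn_mk (q : ℕ) (α : PolyForm ℂ N q) :
    A.realizeOn x hI q (RegularForm.mk I α) =
      MForm.extendZero (U := A.openSet O) (polyFormRealize (A.restrictOpen O) x q α) := by
  rw [realizeOn_apply, regularFormRealize_mk]

/-- Restricting `realizeOn r` to the open piece gives back the holomorphic image.
[cite: Grothendieck1966, (5)] -/
theorem pullback_subtypeVal_realizeOn (q : ℕ) (r : RegularForm I q) :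
    (A.realizeOn x hI q r).pullback 𝓘(ℝ, E) (Subtype.val : A.openSet O → A.carrier) =
      regularFormRealize (A.restrictOpen O) x hI q r :=
  MForm.pullback_subtypeVal_extendZero _

/-- **`realizeOn r` is a local form on the open piece**: smooth on `ψ⁻¹(O(ℂ))`, zero off it.
[cite: Grothendieck1966, (5)–(6)] [cite: BottTu1982Forms, §8 (8.1)] -/
theorem realizeOn_mem_smoothFormsOn (q : ℕ) (r : RegularForm I q) :
    A.realizeOn x hI q r ∈ smoothFormsOn 𝓘(ℝ, E) ℂ (A.openSet O : Set A.carrier) q :=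
  MForm.extendZero_mem_smoothFormsOn (isSmoothForm_regularFormRealize (A.restrictOpen O) x hI q r)

/-- **The holomorphic image on an affine open piece as a local form** — the component map of the
realisation of the algebraic Čech–de Rham complex of an affine cover inside the smooth one
(`Geometry/Kaehler/CechDeRham`); `ℝ`-linear into the `ℝ`-submodule `smoothFormsOn`.
[cite: Grothendieck1966, p. 96 (6)] [cite: BottTu1982Forms, §8 (8.1)] -/
def localRealize (q : ℕ) :
    RegularForm I q →ₗ[ℝ] smoothFormsOn 𝓘(ℝ, E) ℂ (A.openSet O : Set A.carrier) q :=
  LinearMap.codRestrict _ ((A.realizeOn x hI q).restrictScalars ℝ)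
    (A.realizeOn_mem_smoothFormsOn x hI q)

/-- Underlying form of `localRealize`. [cite: Grothendieck1966, p. 96 (6)] -/
@[simp]
theorem coe_localRealize (q : ℕ) (r : RegularForm I q) :
    (A.localRealize x hI q r : MForm 𝓘(ℝ, E) A.carrier ℂ q) = A.realizeOn x hI q r :=
  rfl

/-- **The local realisation is a cochain map**: `d_U (r^an) = (dr)^an` on the open piece
(`regularFormRealize_d`, `d` commutes with extension by zero). [cite: Grothendieck1966, (5)] -/
theorem localD_localRealize (q : ℕ) (r : RegularForm I q) :
    localD 𝓘(ℝ, E) ℂ q (A.openSet O).isOpen (A.localRealize x hI q r) =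
      A.localRealize x hI (q + 1) (RegularForm.d I r) := by
  refine Subtype.ext ?_
  rw [coe_localD, coe_localRealize, coe_localRealize, realizeOn_apply, realizeOn_apply,
    regularFormRealize_d]
  exact (MForm.extendZero_mextDeriv (isSmoothForm_regularFormRealize (A.restrictOpen O) x hI q r)).symm

end AnalyticModel

/-! ### Compatibility with restriction to a smaller affine open -/

variable {A} in
/-- **Local realisations restrict**: for affine opens `O₁ ≤ O₂` of `Y` with coordinates `x₁`, `x₂`,
a polynomial lift `F` of the inclusion `Y|_{O₁} ⟶ Y|_{O₂}` on them, and relations `I₂ · F ⊆ I₁`,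
restricting the local realisation over `O₂` to the open piece over `O₁` is the local realisation
over `O₁` of `F^* r` — the naturality of Grothendieck's comparison map
(`regularFormRealize_pullback_anMap`) along an inclusion whose analytification is the inclusion
of open pieces (`anMap_restrictOpen_homOfLE`). [cite: Grothendieck1966, (5)–(6)] -/
theorem AnalyticModel.restr_realizeOn [SmoothOfRelativeDimension m Y.hom] {O₁ O₂ : Y.left.Opens}
    [IsAffine (Motives.openSubschemeOver Y O₁).left] [IsAffine (Motives.openSubschemeOver Y O₂).left]
    (h : O₁ ≤ O₂) {N₁ N₂ : ℕ} {x₁ : Fin N₁ → Γ((Motives.openSubschemeOver Y O₁).left, ⊤)}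
    {x₂ : Fin N₂ → Γ((Motives.openSubschemeOver Y O₂).left, ⊤)}
    {F : Fin N₂ → MvPolynomial (Fin N₁) ℂ}
    (hF : ∀ j, (Motives.openSubschemeOverHomOfLE Y h).left.appTop (x₂ j) =
      coordPresentation (Motives.openSubschemeOver Y O₁) x₁ (F j))
    {I₁ : Ideal (MvPolynomial (Fin N₁) ℂ)} {I₂ : Ideal (MvPolynomial (Fin N₂) ℂ)}
    (hI₁ : I₁ ≤ RingHom.ker (coordPresentation (Motives.openSubschemeOver Y O₁) x₁))
    (hI₂ : I₂ ≤ RingHom.ker (coordPresentation (Motives.openSubschemeOver Y O₂) x₂))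
    (hFI : I₂.map (bind₁ F : MvPolynomial (Fin N₂) ℂ →ₐ[ℂ] MvPolynomial (Fin N₁) ℂ) ≤ I₁)
    (q : ℕ) (r : RegularForm I₂ q) :
    (A.realizeOn x₂ hI₂ q r).restr (A.openSet O₁ : Set A.carrier) =
      A.realizeOn x₁ hI₁ q (RegularForm.comap F hFI q r) := by
  rw [AnalyticModel.realizeOn_apply, AnalyticModel.realizeOn_apply,
    ← regularFormRealize_pullback_anMap (A.restrictOpen O₁) (A.restrictOpen O₂)
      (Motives.openSubschemeOverHomOfLE Y h) hF hI₁ hI₂ hFI q r,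
    A.anMap_restrictOpen_homOfLE h]
  exact (MForm.extendZero_pullback_inclusion (A.openSet_mono h) _).symm

variable {A} in
/-- The same compatibility in `smoothFormsOn`: `restrictₗ ∘ localRealize_{O₂} = localRealize_{O₁} ∘ F^*`
— the commutation of the realisation with the Čech restriction maps. [cite: Grothendieck1966, (5)–(6)] -/
theorem AnalyticModel.restrictₗ_localRealize [SmoothOfRelativeDimension m Y.hom]
    {O₁ O₂ : Y.left.Opens}
    [IsAffine (Motives.openSubschemeOver Y O₁).left] [IsAffine (Motives.openSubschemeOver Y O₂).left]
    (h : O₁ ≤ O₂) {N₁ N₂ : ℕ} {x₁ : Fin N₁ → Γ((Motives.openSubschemeOver Y O₁).left, ⊤)}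
    {x₂ : Fin N₂ → Γ((Motives.openSubschemeOver Y O₂).left, ⊤)}
    {F : Fin N₂ → MvPolynomial (Fin N₁) ℂ}
    (hF : ∀ j, (Motives.openSubschemeOverHomOfLE Y h).left.appTop (x₂ j) =
      coordPresentation (Motives.openSubschemeOver Y O₁) x₁ (F j))
    {I₁ : Ideal (MvPolynomial (Fin N₁) ℂ)} {I₂ : Ideal (MvPolynomial (Fin N₂) ℂ)}
    (hI₁ : I₁ ≤ RingHom.ker (coordPresentation (Motives.openSubschemeOver Y O₁) x₁))
    (hI₂ : I₂ ≤ RingHom.ker (coordPresentation (Motives.openSubschemeOver Y O₂) x₂))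
    (hFI : I₂.map (bind₁ F : MvPolynomial (Fin N₂) ℂ →ₐ[ℂ] MvPolynomial (Fin N₁) ℂ) ≤ I₁)
    (q : ℕ) (r : RegularForm I₂ q) :
    restrictₗ 𝓘(ℝ, E) ℂ q (A.openSet O₁).isOpen (A.openSet_mono h) (A.localRealize x₂ hI₂ q r) =
      A.localRealize x₁ hI₁ q (RegularForm.comap F hFI q r) :=
  Subtype.ext (AnalyticModel.restr_realizeOn h hF hI₁ hI₂ hFI q r)

end HodgeTheory

end Literature.AlgebraicGeometry.HodgeTheory

end
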